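import Summits.CriticalPhenomena.Ising3DConformalLimit.Theses.MonotoneBlocking
import Summits.CriticalPhenomena.Ising3DConformalLimit.Theses.MirrorHoelderCompactness
import Literature.Probability.LatticeModels.HighDimPointwiseTriviality
import Literature.Probability.LatticeModels.ImprovedTreeDiagramBoundProofs
import Summits.CriticalPhenomena.Ising3DConformalLimit.Theorems.HyperoctahedralRPExistsScaleCovariantLimitUniformRegularityOfPinnedLimit
import Summits.CriticalPhenomena.Ising3DConformalLimit.Theorems.HyperoctahedralRPExistsScaleCovariantLimitNonSeparableModulusOfUniformRegularity
import Summits.CriticalPhenomena.Ising3DConformalLimit.Theorems.HyperoctahedralRPExistsScaleCovariantLimitCompactnessItemMapsDoubling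
import Summits.CriticalPhenomena.Ising3DConformalLimit.Theorems.MonotoneBlockingNonSeparableModulusAxialPincer
import HarnessLib

/-!
# Disproof work file — crux `NonSeparableModulus` (NS, item stmt-CriticalPhenomena-6152)

Standing adversary `refuter-cdisprove-stmt-CriticalPhenomena-6152-0`, routes `MonotoneBlocking` /
`MirrorHoelderCompactness`, sub-problem `CriticalPhenomena/Ising3DConformalLimit`.

FINDINGS (cycle 1) — see the section docstrings:
* §1 `Sep`, `F`, `Clause`: the crux unbundled (`nonSeparableModulus_iff`, `Iff.rfl`).
* §2 LOAD-BEARING hypotheses (dropped one at a time, each refuted by an explicit witness):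
  `false_without_nonCoincident` (K = {(0,0)}, n = 2), `false_without_compact` (K = NonCoincident 3 2),
  both by the LATTICE-COINCIDENCE mechanism: at a lattice-coincident pair the pinned zoom is
  `1/g(⌊δ⁻¹⌋) → ∞`, one far axial cell away it is `≤ ½/g(⌊δ⁻¹⌋)`.
  LANDED (definition-free restatements): `Theorems/NonSeparableModulus/Negative/LatticeCoincidence.lean`
  (p159716, `NonSeparableModulusNegative.nonSeparableModulus_false_without_nonCoincident/_compact`).
* §3 NATURAL STRENGTHENING refuted: `not_uniformMesh` — the mesh threshold `δ₀` cannot be chosen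
  before `K` (wall-crossing witness, needs `g(1) < 1`, proved here from GKS + infrared decay).
  LANDED: `Theorems/NonSeparableModulus/Negative/MeshThreshold.lean` (p159933,
  `nonSeparableModulus_false_uniformMesh`, `criticalTwoPoint_e0_lt_one`).
* §4 WHY NS ITSELF RESISTS: Summit ⟹ NS (`nonSeparableModulus_of_summit`), NS ⟸ TwoPointDoubling (6150)
  by landed item maps, NS ⟹ 6150 kernel-checked in `Cruxes/NonSeparableModulus/AxialPincer.lean`:
  a disproof of NS is a disproof of the conjunct `Ising3DConformalLimit` and, equivalently, a failure of
  axial doubling of `⟨σ₀σ_{ne₀}⟩_{β_c}` — consistent with every catalogued two-point fact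
  (`Literature.Barriers.CriticalPhenomena.AxisProfileAxiomaticsNoDoubling`) but believed false
  (`g(2n)/g(n) → 2^{-1.036}`). The `¬ m-separable` restriction is NOT load-bearing
  (`withoutNonSep_of_twoPointDoubling`). LANDING: `Theorems/NonSeparableModulus/Negative/NecessaryForSummit.lean`
  (p160017: `not_summit_of_not_nonSeparableModulus`, `doubling_fails_of_not_nonSeparableModulus`,
  `onePointModulus_of_twoPointDoubling`, `not_summit_of_not_onePointModulus`).
* §5 no attackable stub (the picked line's only stub is item 6150 verbatim); §6 near-misses.
-/

noncomputable section

namespace Summit.CriticalPhenomena.Ising3DConformalLimit.Cruxes.NonSeparableModulus.Disproof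

open Literature.Probability.LatticeModels
open Summit.CriticalPhenomena.Ising3DConformalLimit.Theses

/-! ## §1 The crux unbundled -/

/-- Points of `ℝ³`. -/
abbrev E : Type := EuclideanSpace ℝ (Fin 3)

/-- The nine-normal `m`-separability predicate of the crux (verbatim): `x i` is `m`-ahead of, or
`m`-behind, every other point along one of `eᵢ`, `eᵢ + eⱼ`, `eᵢ − eⱼ`. -/
def Sep (n : ℕ) (m : ℝ) (x : Fin n → E) (i : Fin n) : Prop :=
  ∃ u : E, (∃ i j : Fin 3, i ≠ j ∧ (u = EuclideanSpace.single i 1 ∨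
      u = EuclideanSpace.single i 1 + EuclideanSpace.single j 1 ∨
      u = EuclideanSpace.single i 1 - EuclideanSpace.single j 1)) ∧
    ((∀ j : Fin n, j ≠ i → inner ℝ u (x j) + m ≤ inner ℝ u (x i)) ∨
      (∀ j : Fin n, j ≠ i → inner ℝ u (x i) + m ≤ inner ℝ u (x j)))

/-- The pinning `ρ★(δ) = ⟨σ₀σ_{⌊δ⁻¹⌋e₀}⟩^{-1/2}` of the crux (verbatim). -/
def rhoStar : ℝ → ℝ := fun δ : ℝ => (criticalTwoPoint 3 (Pi.single 0 ⌊δ⁻¹⌋)) ^ (-(1/2:ℝ))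

/-- The pinned zoom `F_n^δ(x) = ρ★(δ)ⁿ ⟨∏ σ_{⌊x_k/δ⌋}⟩_{β_c}`. -/
def F (n : ℕ) (δ : ℝ) (x : Fin n → E) : ℝ := rescaledCorrelator (criticalCorr 3) rhoStar n δ x

/-- The modulus clause of the crux for data `(n, K, ε, m, η, δ₀)`. -/
def Clause (n : ℕ) (K : Set (Fin n → E)) (ε m η δ₀ : ℝ) : Prop :=
  ∀ δ ∈ Set.Ioo 0 δ₀, ∀ x ∈ K, ∀ (i : Fin n) (y : E), ‖y - x i‖ < η → ¬ Sep n m x i →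
    |F n δ (Function.update x i y) - F n δ x| < ε

/-- The crux, unbundled (definitional). -/
theorem nonSeparableModulus_iff :
    MonotoneBlocking.NonSeparableModulus ↔
      ∀ (n : ℕ) (K : Set (Fin n → E)), K ⊆ NonCoincident 3 n → IsCompact K → ∀ ε : ℝ, 0 < ε →
        ∃ m η δ₀ : ℝ, 0 < m ∧ 0 < η ∧ 0 < δ₀ ∧ Clause n K ε m η δ₀ :=
  Iff.rfl

/-- The two route copies of the crux are the same proposition. -/
theorem mirror_iff : MirrorHoelderCompactness.NonSeparableModulus ↔ MonotoneBlocking.NonSeparableModulus :=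
  Iff.rfl

/-! ## §1b Lattice dictionary -/

/-- `g k = ⟨σ₀σ_{k e₀}⟩_{β_c}` along the first axis. -/
def g (k : ℤ) : ℝ := criticalTwoPoint 3 (Pi.single 0 k)

theorem g_pos (k : ℤ) : 0 < g k := by
  unfold g
  by_cases hk : k = 0
  · subst hk; simp [criticalTwoPoint_zero']
  · obtain ⟨c, C, hc, hb⟩ := criticalTwoPoint_bounds_holds (d := 3) le_rfl
    have hx : (Pi.single 0 k : Site 3) ≠ 0 := by
      intro h0; have := congr_fun h0 0; simp at this; exact hk this
    exact lt_of_lt_of_le (mul_pos hc (Real.rpow_pos_of_pos (norm_pos_iff.2 hx) _)) (hb _ hx).1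

/-- The infrared bound on the axis: `g k ≤ C / k` for `k ≥ 1`, with the constant of
`criticalTwoPoint_bounds_holds`. -/
theorem g_decay : ∃ C : ℝ, 0 ≤ C ∧ ∀ k : ℤ, 0 < k → g k ≤ C / k := by
  obtain ⟨c, C, -, hb⟩ := criticalTwoPoint_bounds_holds (d := 3) le_rfl
  refine ⟨max C 0, le_max_right _ _, fun k hk => ?_⟩
  have hx : (Pi.single 0 k : Site 3) ≠ 0 := by
    intro h0; have := congr_fun h0 0; simp at this; omega
  have h1 := (hb _ hx).2
  have hnorm : ‖(Pi.single 0 k : Site 3)‖ = (k : ℝ) := by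
    rw [Pi.norm_single, Int.norm_eq_abs]
    exact abs_of_pos (by exact_mod_cast hk)
  rw [hnorm, show (-(((3:ℕ) : ℝ) - 2)) = (-1 : ℝ) by norm_num, Real.rpow_neg_one] at h1
  have hkpos : (0 : ℝ) < k := by exact_mod_cast hk
  calc criticalTwoPoint 3 (Pi.single 0 k) ≤ C * (k : ℝ)⁻¹ := h1
    _ ≤ max C 0 * (k : ℝ)⁻¹ := mul_le_mul_of_nonneg_right (le_max_left _ _) (inv_nonneg.2 hkpos.le)
    _ = max C 0 / k := by rw [div_eq_mul_inv]

theorem rhoStar_sq (δ : ℝ) : rhoStar δ ^ 2 = (g ⌊δ⁻¹⌋)⁻¹ := by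
  change ((g ⌊δ⁻¹⌋) ^ (-(1/2:ℝ))) ^ 2 = _
  rw [← Real.rpow_natCast, ← Real.rpow_mul (g_pos _).le]
  norm_num
  exact Real.rpow_neg_one _

/-- The unit vector `e₀`. -/
def e0 : E := EuclideanSpace.single 0 1

theorem e0_apply (k : Fin 3) : e0 k = if k = 0 then 1 else 0 := by
  simp [e0]

theorem norm_smul_e0 (c : ℝ) : ‖c • e0‖ = |c| := by
  rw [norm_smul, Real.norm_eq_abs]; simp [e0]

theorem inner_smul_e0 (u : E) (c : ℝ) : inner ℝ u (c • e0) = c * u 0 := by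
  rw [real_inner_smul_right]
  simp [e0, EuclideanSpace.inner_single_right]

theorem latticeApprox_smul_e0 (δ c : ℝ) : latticeApprox δ (c • e0) = Pi.single 0 ⌊c / δ⌋ := by
  funext k
  rw [latticeApprox_apply]
  by_cases hk : k = 0
  · subst hk; simp [e0_apply]
  · simp [e0_apply, hk]

theorem latticeApprox_zero (δ : ℝ) : latticeApprox δ (0 : E) = 0 := by
  funext k; simp [latticeApprox_apply]

/-- The pinned pair zoom: `F_2^δ(p, q) = ρ★(δ)² ⟨σ₀ σ_{[q/δ]−[p/δ]}⟩`. -/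
theorem F_two (δ : ℝ) (x : Fin 2 → E) :
    F 2 δ x = rhoStar δ ^ 2 * criticalTwoPoint 3 (latticeApprox δ (x 1) - latticeApprox δ (x 0)) := by
  unfold F
  rw [rescaledCorrelator_apply]
  congr 1
  have : (fun i => latticeApprox δ (x i)) = ![latticeApprox δ (x 0), latticeApprox δ (x 1)] := by
    funext i; fin_cases i <;> rfl
  rw [this, criticalCorr_two_pair]

/-! ## §2 Load-bearing hypotheses

### The lattice-coincidence mechanism

At a configuration whose two points share a lattice cell at mesh `δ`, `F_2^δ = ρ★(δ)²·⟨σ_a σ_a⟩ =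
1/g(⌊δ⁻¹⌋)`, which diverges as `δ → 0` (`g(N) ≤ C/N`); moving one point by `η/2` along `e₀` puts it
`R = ⌊η/(2δ)⌋` cells away, where `⟨σ₀σ_{Re₀}⟩ ≤ C/R ≤ ½`. The jump `≥ ½/g(N) ≥ 1` beats `ε = 1`.
Compactness inside `NonCoincident` is exactly what keeps lattice coincidence away (`δ₀ ≪ sep K`). -/

/-- Core estimate: for every `η, δ₀ > 0` and every extra smallness request `b > 0` there is a mesh
`δ < δ₀`, `δ ≤ b`, at which `1/g(⌊δ⁻¹⌋) − ⟨σ₀σ_{⌊η/2/δ⌋e₀}⟩/g(⌊δ⁻¹⌋) ≥ 1`. -/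
theorem exists_mesh_jump {η δ₀ b : ℝ} (hη : 0 < η) (hδ₀ : 0 < δ₀) (hb : 0 < b) :
    ∃ δ : ℝ, 0 < δ ∧ δ < δ₀ ∧ δ ≤ b ∧
      1 ≤ (g ⌊δ⁻¹⌋)⁻¹ * 1 - (g ⌊δ⁻¹⌋)⁻¹ * g ⌊η / 2 / δ⌋ := by
  obtain ⟨C, hC0, hC⟩ := g_decay
  set δ : ℝ := min (min (δ₀ / 2) b) (min (η / (4 * C + 4)) (1 / (2 * C + 2))) with hδdef
  have hA : 0 < 4 * C + 4 := by positivity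
  have hB : 0 < 2 * C + 2 := by positivity
  have hδpos : 0 < δ := by
    rw [hδdef]
    refine lt_min (lt_min (by positivity) hb) (lt_min (div_pos hη hA) (div_pos one_pos hB))
  have hδ₀' : δ < δ₀ := by
    have : δ ≤ δ₀ / 2 := (min_le_left _ _).trans (min_le_left _ _)
    linarith
  have hδb : δ ≤ b := (min_le_left _ _).trans (min_le_right _ _)
  have hδη : δ ≤ η / (4 * C + 4) := (min_le_right _ _).trans (min_le_left _ _)
  have hδ1 : δ ≤ 1 / (2 * C + 2) := (min_le_right _ _).trans (min_le_right _ _)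
  refine ⟨δ, hδpos, hδ₀', hδb, ?_⟩
  -- the two integers
  set N : ℤ := ⌊δ⁻¹⌋ with hN
  set R : ℤ := ⌊η / 2 / δ⌋ with hR
  have hNreal : 2 * C + 1 < (N : ℝ) := by
    have h1 : 2 * C + 2 ≤ δ⁻¹ := by
      rw [le_inv_comm₀ hB hδpos]; simpa [one_div] using hδ1
    have h2 := Int.sub_one_lt_floor δ⁻¹
    rw [← hN] at h2; linarith
  have hRreal : 2 * C + 1 < (R : ℝ) := by
    have h1 : 2 * C + 2 ≤ η / 2 / δ := by
      rw [le_div_iff₀ hδpos]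
      have := (le_div_iff₀ hA).1 hδη
      linarith
    have h2 := Int.sub_one_lt_floor (η / 2 / δ)
    rw [← hR] at h2; linarith
  have hNpos : (0 : ℝ) < N := by linarith
  have hRpos : (0 : ℝ) < R := by linarith
  have hN0 : 0 < N := by exact_mod_cast hNpos
  have hR0 : 0 < R := by exact_mod_cast hRpos
  -- g N ≤ 1/2 and g R ≤ 1/2
  have hgN : g N ≤ 1 / 2 := by
    refine (hC N hN0).trans ?_
    rw [div_le_iff₀ hNpos]; linarith
  have hgR : g R ≤ 1 / 2 := by
    refine (hC R hR0).trans ?_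
    rw [div_le_iff₀ hRpos]; linarith
  have hgNpos := g_pos N
  have hinv : 2 ≤ (g N)⁻¹ := by
    rw [le_inv_comm₀ two_pos hgNpos]; linarith
  have : (g N)⁻¹ * 1 - (g N)⁻¹ * g R = (g N)⁻¹ * (1 - g R) := by ring
  rw [this]
  calc (1 : ℝ) = 2 * (1 / 2) := by norm_num
    _ ≤ (g N)⁻¹ * (1 - g R) := mul_le_mul hinv (by linarith) (by norm_num) (by positivity)

/-- A tie kills separability: if another point `x j` coincides with `x i`, then `(x, i)` is not
`m`-separable for any `m > 0` (by any vector whatsoever). -/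
theorem not_sep_of_eq {n : ℕ} {m : ℝ} (hm : 0 < m) {x : Fin n → E} {i j : Fin n} (hji : j ≠ i)
    (h : x j = x i) : ¬ Sep n m x i := by
  rintro ⟨u, -, hsep | hsep⟩
  · have := hsep j hji; rw [h] at this; linarith
  · have := hsep j hji; rw [h] at this; linarith

/-- **NS without `K ⊆ NonCoincident`** (compactness kept). -/
def WithoutNonCoincident : Prop :=
  ∀ (n : ℕ) (K : Set (Fin n → E)), IsCompact K → ∀ ε : ℝ, 0 < ε →
    ∃ m η δ₀ : ℝ, 0 < m ∧ 0 < η ∧ 0 < δ₀ ∧ Clause n K ε m η δ₀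

/-- **`K ⊆ NonCoincident` is load-bearing**: at the coincident pair `K = {(0,0)}` (compact, `n = 2`,
the moving point tied with its partner hence never separable) the pinned zoom is `1/g(⌊δ⁻¹⌋)`, and the
move `0 ↦ (η/2)e₀` drops it below `½/g(⌊δ⁻¹⌋)`: a jump `≥ 1` at every small mesh. Any proof of NS must
use non-coincidence (it is what makes `δ₀ ≪ sep K` separate the lattice shadows). -/
theorem false_without_nonCoincident : ¬ WithoutNonCoincident := by
  intro h
  obtain ⟨m, η, δ₀, hm, hη, hδ₀, hcl⟩ :=
    h 2 {fun _ => (0 : E)} isCompact_singleton 1 one_pos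
  obtain ⟨δ, hδ, hδδ₀, -, hjump⟩ := exists_mesh_jump hη hδ₀ one_pos
  set x : Fin 2 → E := fun _ => 0 with hx
  set y : E := (η / 2) • e0 with hy
  have hyx : ‖y - x 0‖ < η := by
    rw [hx, hy]; simp only [sub_zero, norm_smul_e0]
    rw [abs_of_pos (by positivity)]; linarith
  have hns : ¬ Sep 2 m x 0 := not_sep_of_eq hm (j := 1) (by decide) rfl
  have key := hcl δ ⟨hδ, hδδ₀⟩ x rfl 0 y hyx hns
  -- evaluate both zooms
  have hFx : F 2 δ x = (g ⌊δ⁻¹⌋)⁻¹ * 1 := by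
    rw [F_two, rhoStar_sq, hx]
    simp only [latticeApprox_zero, sub_self, criticalTwoPoint_zero']
  have hFy : F 2 δ (Function.update x 0 y) = (g ⌊δ⁻¹⌋)⁻¹ * g ⌊η / 2 / δ⌋ := by
    rw [F_two, rhoStar_sq, Function.update_of_ne (by decide), Function.update_self, hy,
      latticeApprox_smul_e0]
    simp only [hx, latticeApprox_zero, zero_sub, criticalTwoPoint_neg]
    rfl
  rw [hFx, hFy] at key
  have := neg_abs_le ( (g ⌊δ⁻¹⌋)⁻¹ * g ⌊η / 2 / δ⌋ - (g ⌊δ⁻¹⌋)⁻¹ * 1)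
  linarith [abs_sub_comm ((g ⌊δ⁻¹⌋)⁻¹ * g ⌊η / 2 / δ⌋) ((g ⌊δ⁻¹⌋)⁻¹ * 1)]


/-- Coordinates of a nine-normal are `0` or `±1`. -/
theorem abs_apply_le_one_of_nineNormal {u : E}
    (hu : ∃ i j : Fin 3, i ≠ j ∧ (u = EuclideanSpace.single i 1 ∨
      u = EuclideanSpace.single i 1 + EuclideanSpace.single j 1 ∨
      u = EuclideanSpace.single i 1 - EuclideanSpace.single j 1)) (k : Fin 3) :
    |u k| ≤ 1 := by
  obtain ⟨i, j, hij, rfl | rfl | rfl⟩ := hu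
  · by_cases h1 : k = i
    · subst h1; simp
    · simp [h1]
  · by_cases h1 : k = i
    · subst h1; simp [hij]
    · by_cases h2 : k = j
      · subst h2; simp [h1]
      · simp [h1, h2]
  · by_cases h1 : k = i
    · subst h1; simp [hij]
    · by_cases h2 : k = j
      · subst h2; simp [h1]
      · simp [h1, h2]

/-- A pair `(0, t e₀)` with `|t| < m` is not `m`-separable at its first point by any nine-normal. -/
theorem not_sep_pair_small {m t : ℝ} (ht : |t| < m) : ¬ Sep 2 m ![0, t • e0] 0 := by
  rintro ⟨u, hu, hsep | hsep⟩
  · have h := hsep 1 (by decide)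
    simp only [Matrix.cons_val_one, Matrix.cons_val_zero, inner_zero_right,
      inner_smul_e0] at h
    have hu0 := abs_apply_le_one_of_nineNormal hu 0
    have : |t * u 0| ≤ |t| := by
      rw [abs_mul]; exact mul_le_of_le_one_right (abs_nonneg _) hu0
    have := neg_abs_le (t * u 0)
    linarith
  · have h := hsep 1 (by decide)
    simp only [Matrix.cons_val_one, Matrix.cons_val_zero, inner_zero_right,
      inner_smul_e0] at h
    have hu0 := abs_apply_le_one_of_nineNormal hu 0
    have : |t * u 0| ≤ |t| := by
      rw [abs_mul]; exact mul_le_of_le_one_right (abs_nonneg _) hu0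
    have := le_abs_self (t * u 0)
    linarith

/-- **NS without `IsCompact K`** (non-coincidence kept). -/
def WithoutCompact : Prop :=
  ∀ (n : ℕ) (K : Set (Fin n → E)), K ⊆ NonCoincident 3 n → ∀ ε : ℝ, 0 < ε →
    ∃ m η δ₀ : ℝ, 0 < m ∧ 0 < η ∧ 0 < δ₀ ∧ Clause n K ε m η δ₀

/-- **Compactness is load-bearing**: on `K = NonCoincident 3 2` itself (not compact) the pairs
`(0, (δ/2)e₀)` are non-coincident, NOT `m`-separable once `δ < m` (all nine inner products are
`≤ δ/2`), yet lattice-coincident at mesh `δ`: the same jump `≥ 1` as in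
`false_without_nonCoincident`. So the modulus cannot be uniform over all of `NonCoincident`:
`η, δ₀` must shrink with `sep K`. -/
theorem false_without_compact : ¬ WithoutCompact := by
  intro h
  obtain ⟨m, η, δ₀, hm, hη, hδ₀, hcl⟩ := h 2 (NonCoincident 3 2) subset_rfl 1 one_pos
  obtain ⟨δ, hδ, hδδ₀, hδm, hjump⟩ := exists_mesh_jump hη hδ₀ hm
  set x : Fin 2 → E := ![0, (δ / 2) • e0] with hx
  set y : E := (η / 2) • e0 with hy
  have hxK : x ∈ NonCoincident 3 2 := by
    refine pair_mem_nonCoincident fun h0 => ?_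
    have := congrArg (fun v : E => ‖v‖) h0
    simp only [norm_zero, norm_smul_e0] at this
    have : |δ / 2| = δ / 2 := abs_of_pos (by positivity)
    linarith
  have hyx : ‖y - x 0‖ < η := by
    rw [hx, hy]; simp only [Matrix.cons_val_zero, sub_zero, norm_smul_e0]
    rw [abs_of_pos (by positivity)]; linarith
  have hns : ¬ Sep 2 m x 0 := by
    rw [hx]; exact not_sep_pair_small (by rw [abs_of_pos (by positivity)]; linarith)
  have key := hcl δ ⟨hδ, hδδ₀⟩ x hxK 0 y hyx hns
  have hhalf : latticeApprox δ ((δ / 2) • e0) = 0 := by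
    rw [latticeApprox_smul_e0, show δ / 2 / δ = 1 / 2 by field_simp,
      show ⌊(1 / 2 : ℝ)⌋ = 0 by norm_num [Int.floor_eq_iff], Pi.single_zero]
  have hFx : F 2 δ x = (g ⌊δ⁻¹⌋)⁻¹ * 1 := by
    rw [F_two, rhoStar_sq, hx]
    simp only [Matrix.cons_val_one, Matrix.cons_val_zero, hhalf, latticeApprox_zero, sub_self,
      criticalTwoPoint_zero']
  have hFy : F 2 δ (Function.update x 0 y) = (g ⌊δ⁻¹⌋)⁻¹ * g ⌊η / 2 / δ⌋ := by
    rw [F_two, rhoStar_sq, Function.update_of_ne (by decide), Function.update_self, hy,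
      latticeApprox_smul_e0]
    simp only [hx, Matrix.cons_val_one, Matrix.cons_val_fin_one, hhalf, zero_sub,
      criticalTwoPoint_neg]
    rfl
  rw [hFx, hFy] at key
  have := neg_abs_le ((g ⌊δ⁻¹⌋)⁻¹ * g ⌊η / 2 / δ⌋ - (g ⌊δ⁻¹⌋)⁻¹ * 1)
  linarith

/-! ## §3 A natural strengthening refuted: the mesh threshold cannot precede `K`

### Four-point dictionary with coincidences (`σ² = 1`) and `g(1) < 1` -/

theorem spinAt_mul_self (a : Site 3) (s : SpinConfig (Site 3)) : spinAt a s * spinAt a s = 1 := by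
  unfold spinAt
  rw [← Int.cast_mul, ← Units.val_mul, Int.units_mul_self]
  simp

/-- `⟨σ_a σ_a σ_b σ_b⟩ = 1`. -/
theorem cc4_aabb (a b : Site 3) : criticalCorr 3 4 ![a, a, b, b] = 1 := by
  have h : criticalCorr 3 4 ![a, a, b, b] = criticalCorr 3 2 ![b, b] := by
    show plusExpect 3 (criticalBeta 3) 0 (spinMonomial ![a, a, b, b]) =
      plusExpect 3 (criticalBeta 3) 0 (spinMonomial ![b, b])
    congr 1
    funext s
    simp only [spinMonomial, Fin.prod_univ_four, Fin.prod_univ_two, Matrix.cons_val_zero,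
      Matrix.cons_val_one, Matrix.cons_val]
    rw [spinAt_mul_self, one_mul]
  rw [h, criticalCorr_two_pair, sub_self, criticalTwoPoint_zero']

/-- `⟨σ_b σ_a σ_b σ_b⟩ = ⟨σ_a σ_b⟩ = ⟨σ₀σ_{b−a}⟩`. -/
theorem cc4_babb (a b : Site 3) : criticalCorr 3 4 ![b, a, b, b] = criticalTwoPoint 3 (b - a) := by
  have h : criticalCorr 3 4 ![b, a, b, b] = criticalCorr 3 2 ![a, b] := by
    show plusExpect 3 (criticalBeta 3) 0 (spinMonomial ![b, a, b, b]) =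
      plusExpect 3 (criticalBeta 3) 0 (spinMonomial ![a, b])
    congr 1
    funext s
    simp only [spinMonomial, Fin.prod_univ_four, Fin.prod_univ_two, Matrix.cons_val_zero,
      Matrix.cons_val_one, Matrix.cons_val]
    calc spinAt b s * spinAt a s * spinAt b s * spinAt b s
        = spinAt a s * spinAt b s * (spinAt b s * spinAt b s) := by ring
      _ = spinAt a s * spinAt b s := by rw [spinAt_mul_self, mul_one]
  rw [h, criticalCorr_two_pair]

/-- GKS II along the axis: `g k · g 1 ≤ g (k+1)`. -/
theorem g_mul_g_one_le (k : ℤ) : g k * g 1 ≤ g (k + 1) := by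
  have h := twoPointPlus_mul_le_twoPointPlus (d := 3) (criticalBeta_nonneg 3)
    (Pi.single 0 k) (Pi.single 0 (k + 1))
  rw [← Pi.single_sub, show k + 1 - k = 1 by ring] at h
  exact h

/-- **Nearest neighbours are not perfectly correlated at `β_c`**: `⟨σ₀σ_{e₀}⟩_{β_c} < 1`.
(If `g 1 = 1`, GKS II forces `g k = 1` for all `k`, against the infrared decay `g k ≤ C/k`.) -/
theorem g_one_lt_one : g 1 < 1 := by
  by_contra hge
  push Not at hge
  have h1 : g 1 = 1 := le_antisymm (criticalTwoPoint_le_one' _) hge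
  have hall : ∀ k : ℕ, g k = 1 := by
    intro k
    induction k with
    | zero => simp [g, criticalTwoPoint_zero']
    | succ k ih =>
      refine le_antisymm (criticalTwoPoint_le_one' _) ?_
      have := g_mul_g_one_le k
      rw [ih, h1, one_mul] at this
      push_cast
      exact this
  obtain ⟨C, hC0, hC⟩ := g_decay
  have hk : (0 : ℤ) < ((⌈C⌉₊ + 1 : ℕ) : ℤ) := by positivity
  have h := hC _ hk
  rw [hall] at h
  have hpos : (0 : ℝ) < ((⌈C⌉₊ + 1 : ℕ) : ℤ) := by positivity
  rw [le_div_iff₀ hpos, one_mul] at h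
  have := Nat.le_ceil C
  push_cast at h
  linarith

/-! ### The wall-crossing witness

Mesh `δ₁ = min δ₀ 1 / 2`, axis coefficients `t(s) = (δ₁ − s, δ₁/4, 3δ₁/2, 7δ₁/4)`, `s ∈ [0, δ₁/2]`:
point `0` is caged between points `1` and `2` (no nine-normal separates it, for any `m`), the family is
compact inside `NonCoincident 3 4`, and for `s > 0` its lattice shadow is `(0, 0, 1, 1)·e₀`
(`F = ρ★⁴`), while the move `x₀ ↦ δ₁ e₀` of length `s` lands on `(1, 0, 1, 1)·e₀` (`F = ρ★⁴ g 1`). -/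

/-- Axis coefficients of the witness family. -/
def tcoef (δ₁ s : ℝ) : Fin 4 → ℝ := ![δ₁ - s, δ₁ / 4, 3 * δ₁ / 2, 7 * δ₁ / 4]

/-- The witness family `cfg δ₁ s = t(s)·e₀`. -/
def cfg (δ₁ s : ℝ) : Fin 4 → E := fun i => tcoef δ₁ s i • e0

theorem continuous_cfg (δ₁ : ℝ) : Continuous (cfg δ₁) := by
  refine continuous_pi fun i => ?_
  have hc : Continuous fun s : ℝ => tcoef δ₁ s i := by
    fin_cases i <;> simp [tcoef] <;> fun_prop
  exact hc.smul continuous_const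

theorem cfg_apply_zero (δ₁ s : ℝ) (i : Fin 4) : cfg δ₁ s i 0 = tcoef δ₁ s i := by
  simp [cfg, e0_apply]

theorem cfg_injective {δ₁ s : ℝ} (hδ₁ : 0 < δ₁) (hs0 : 0 ≤ s) (hs : s ≤ δ₁ / 2) :
    Function.Injective (cfg δ₁ s) := by
  intro i j h
  have h' := congrArg (fun v : E => v 0) h
  simp only [cfg_apply_zero] at h'
  fin_cases i <;> fin_cases j <;>
    first | rfl | (exfalso; simp [tcoef] at h'; linarith)

/-- Point `0` of the witness is caged: not `m`-separable by ANY vector, for any `m > 0`. -/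
theorem cfg_caged {δ₁ s m : ℝ} (hδ₁ : 0 < δ₁) (hs0 : 0 ≤ s) (hs : s ≤ δ₁ / 2) (hm : 0 < m) :
    ¬ Sep 4 m (cfg δ₁ s) 0 := by
  rintro ⟨u, -, h | h⟩
  · have h1 := h 1 (by decide)
    have h2 := h 2 (by decide)
    simp only [cfg, inner_smul_e0, tcoef, Matrix.cons_val_zero, Matrix.cons_val_one,
      Matrix.cons_val] at h1 h2
    nlinarith
  · have h1 := h 1 (by decide)
    have h2 := h 2 (by decide)
    simp only [cfg, inner_smul_e0, tcoef, Matrix.cons_val_zero, Matrix.cons_val_one,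
      Matrix.cons_val] at h1 h2
    nlinarith

/-- Lattice shadow of the witness at mesh `δ₁`, for `0 < s ≤ δ₁/2`: `(0, 0, 1, 1)·e₀`. -/
theorem latticeApprox_cfg {δ₁ s : ℝ} (hδ₁ : 0 < δ₁) (hs0 : 0 < s) (hs : s ≤ δ₁ / 2) :
    (fun i => latticeApprox δ₁ (cfg δ₁ s i)) =
      ![0, 0, Pi.single 0 1, Pi.single 0 1] := by
  funext i
  fin_cases i
  · show latticeApprox δ₁ (tcoef δ₁ s 0 • e0) = 0
    rw [latticeApprox_smul_e0, show ⌊tcoef δ₁ s 0 / δ₁⌋ = 0 from ?_, Pi.single_zero]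
    rw [Int.floor_eq_iff]
    simp only [tcoef, Matrix.cons_val_zero, Int.cast_zero, zero_add]
    constructor
    · exact div_nonneg (by linarith) hδ₁.le
    · rw [div_lt_one hδ₁]; linarith
  · show latticeApprox δ₁ (tcoef δ₁ s 1 • e0) = 0
    rw [latticeApprox_smul_e0, show ⌊tcoef δ₁ s 1 / δ₁⌋ = 0 from ?_, Pi.single_zero]
    rw [Int.floor_eq_iff]
    simp only [tcoef, Matrix.cons_val_one, Matrix.cons_val_zero, Int.cast_zero, zero_add]
    constructor
    · positivity
    · rw [div_lt_one hδ₁]; linarith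
  · show latticeApprox δ₁ (tcoef δ₁ s 2 • e0) = Pi.single 0 1
    rw [latticeApprox_smul_e0, show ⌊tcoef δ₁ s 2 / δ₁⌋ = 1 from ?_]
    rw [Int.floor_eq_iff]
    simp only [tcoef, Matrix.cons_val, Int.cast_one]
    constructor
    · rw [le_div_iff₀ hδ₁]; linarith
    · rw [div_lt_iff₀ hδ₁]; linarith
  · show latticeApprox δ₁ (tcoef δ₁ s 3 • e0) = Pi.single 0 1
    rw [latticeApprox_smul_e0, show ⌊tcoef δ₁ s 3 / δ₁⌋ = 1 from ?_]
    rw [Int.floor_eq_iff]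
    simp only [tcoef, Matrix.cons_val, Int.cast_one]
    constructor
    · rw [le_div_iff₀ hδ₁]; linarith
    · rw [div_lt_iff₀ hδ₁]; linarith

/-- Lattice shadow after the move `x₀ ↦ δ₁ e₀`: `(1, 0, 1, 1)·e₀`. -/
theorem latticeApprox_cfg_update {δ₁ s : ℝ} (hδ₁ : 0 < δ₁) (hs0 : 0 < s) (hs : s ≤ δ₁ / 2) :
    (fun i => latticeApprox δ₁ (Function.update (cfg δ₁ s) 0 (δ₁ • e0) i)) =
      ![Pi.single 0 1, 0, Pi.single 0 1, Pi.single 0 1] := by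
  have h := latticeApprox_cfg hδ₁ hs0 hs
  funext i
  fin_cases i
  · show latticeApprox δ₁ (Function.update (cfg δ₁ s) 0 (δ₁ • e0) 0) = Pi.single 0 1
    rw [Function.update_self, latticeApprox_smul_e0, div_self hδ₁.ne', Int.floor_one]
  · show latticeApprox δ₁ (Function.update (cfg δ₁ s) 0 (δ₁ • e0) 1) = 0
    rw [Function.update_of_ne (by decide)]; exact congr_fun h 1
  · show latticeApprox δ₁ (Function.update (cfg δ₁ s) 0 (δ₁ • e0) 2) = Pi.single 0 1
    rw [Function.update_of_ne (by decide)]; exact congr_fun h 2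
  · show latticeApprox δ₁ (Function.update (cfg δ₁ s) 0 (δ₁ • e0) 3) = Pi.single 0 1
    rw [Function.update_of_ne (by decide)]; exact congr_fun h 3

/-- **NS with the mesh threshold chosen BEFORE the compact set** (`∃ δ₀ ∀ K` instead of `∀ K ∃ δ₀`);
it trivially implies NS. -/
def UniformMesh : Prop :=
  ∃ δ₀ : ℝ, 0 < δ₀ ∧ ∀ (n : ℕ) (K : Set (Fin n → E)), K ⊆ NonCoincident 3 n → IsCompact K →
    ∀ ε : ℝ, 0 < ε → ∃ m η : ℝ, 0 < m ∧ 0 < η ∧ Clause n K ε m η δ₀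

theorem nonSeparableModulus_of_uniformMesh (h : UniformMesh) : MonotoneBlocking.NonSeparableModulus := by
  obtain ⟨δ₀, hδ₀, h⟩ := h
  intro n K hK hKc ε hε
  obtain ⟨m, η, hm, hη, hcl⟩ := h n K hK hKc ε hε
  exact ⟨m, η, δ₀, hm, hη, hδ₀, hcl⟩

/-- **The mesh threshold is load-bearing in its position**: `δ₀` cannot be chosen uniformly in `K`
(in particular NS fails with `δ ∈ (0,1)` unrestricted). Witness: the caged wall-crossing family
`cfg δ₁ s`, `s ∈ [0, δ₁/2]`, at the admissible mesh `δ₁ < δ₀`; the jump is `ρ★(δ₁)⁴ (1 − g 1) > 0`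
however small `η` is. Lattice artefact, excluded in NS exactly by `δ₀ = δ₀(K) ≪ sep K`. -/
theorem not_uniformMesh : ¬ UniformMesh := by
  rintro ⟨δ₀, hδ₀, h⟩
  set δ₁ : ℝ := min δ₀ 1 / 2 with hδ₁def
  have hδ₁ : 0 < δ₁ := by positivity
  have hδ₁δ₀ : δ₁ < δ₀ := by
    have := min_le_left δ₀ 1; rw [hδ₁def]; linarith
  set K : Set (Fin 4 → E) := cfg δ₁ '' Set.Icc 0 (δ₁ / 2) with hKdef
  have hKc : IsCompact K := (isCompact_Icc.image (continuous_cfg δ₁))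
  have hKs : K ⊆ NonCoincident 3 4 := by
    rintro _ ⟨s, ⟨hs0, hs⟩, rfl⟩
    exact cfg_injective hδ₁ hs0 hs
  set J : ℝ := rhoStar δ₁ ^ 4 * (1 - g 1) with hJ
  have hJpos : 0 < J := mul_pos (pow_pos (Real.rpow_pos_of_pos (g_pos _) _) 4) (by linarith [g_one_lt_one])
  obtain ⟨m, η, hm, hη, hcl⟩ := h 4 K hKs hKc J hJpos
  -- the witness pair
  set s : ℝ := min (δ₁ / 2) (η / 2) with hsdef
  have hs0 : 0 < s := by positivity
  have hs : s ≤ δ₁ / 2 := min_le_left _ _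
  have hsη : s ≤ η / 2 := min_le_right _ _
  have hxK : cfg δ₁ s ∈ K := ⟨s, ⟨hs0.le, hs⟩, rfl⟩
  have hyx : ‖δ₁ • e0 - cfg δ₁ s 0‖ < η := by
    simp only [cfg, tcoef, Matrix.cons_val_zero, ← sub_smul, norm_smul_e0]
    rw [show δ₁ - (δ₁ - s) = s by ring, abs_of_pos hs0]; linarith
  have key := hcl δ₁ ⟨hδ₁, hδ₁δ₀⟩ (cfg δ₁ s) hxK 0 (δ₁ • e0) hyx (cfg_caged hδ₁ hs0.le hs hm)
  have hFx : F 4 δ₁ (cfg δ₁ s) = rhoStar δ₁ ^ 4 * 1 := by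
    unfold F; rw [rescaledCorrelator_apply, latticeApprox_cfg hδ₁ hs0 hs, cc4_aabb]
  have hFy : F 4 δ₁ (Function.update (cfg δ₁ s) 0 (δ₁ • e0)) = rhoStar δ₁ ^ 4 * g 1 := by
    unfold F; rw [rescaledCorrelator_apply, latticeApprox_cfg_update hδ₁ hs0 hs, cc4_babb, sub_zero]
    rfl
  rw [hFx, hFy] at key
  have : rhoStar δ₁ ^ 4 * g 1 - rhoStar δ₁ ^ 4 * 1 = -J := by rw [hJ]; ring
  rw [this, abs_neg, abs_of_pos hJpos] at key
  exact lt_irrefl _ key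


/-! ## §4 Why NS itself resists: it is necessary for the summit, and it is item 6150

* `nonSeparableModulus_of_summit` / `not_summit_of_not_nonSeparableModulus`: the conjunct
  `Ising3DConformalLimit` gives a non-degenerate pointwise limit, hence (landed
  `hasPointwiseScalingLimit_rhoPin`) a PINNED full-filter limit, hence (landed
  `stub_uniformRegularity_of_pinnedLimit`) `UniformRegularity`, hence (landed
  `stub_nonSeparableModulus_of_uniformRegularity`, separability unused) NS. So `¬NS → ¬Summit`:
  a refutation of this crux refutes the sub-problem; no counterexample can come from anything the
  summit tolerates.
* `nonSeparableModulus_of_twoPointDoubling`: NS ⟸ item 6150 (landed chain); the converse NS ⟹ 6150 is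
  the lead's LANDED `MonotoneBlockingNonSeparableModulusAxialPincer.twoPointDoubling_of_nonSeparableModulus`
  (p159449), whence `not_nonSeparableModulus_iff_doubling_fails` and `nonSeparableModulus_iff_withoutNonSep`
  below (landed restatements: `Negative/Equivalences.lean`, p160302).
  Net: ¬NS ⟺ ¬(axial doubling `κ g(n) ≤ g(2n)`), i.e. a disproof needs a
  subsequence `g(2n_k)/g(n_k) → 0` of the ACTUAL critical two-point function; the catalogued axis facts
  (`0 < g ≤ 1`, `c/n² ≤ g(n) ≤ C/n`, MMS monotonicity, RP log-convexity of `g(k+2)/g(k+1)`) admit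
  non-doubling profiles (`Literature.Barriers.CriticalPhenomena.AxisProfileAxiomaticsNoDoubling`), so
  no contradiction is derivable from the tree's two-point knowledge either way; numerics
  (`g(2n)/g(n) → 2^{-(1+η)} ≈ 0.488`) say doubling holds.
* `withoutNonSep_of_twoPointDoubling`: the `¬ m-separable` restriction is NOT load-bearing in any known
  derivation — the hypothesis-free one-point modulus already follows from 6150. -/

open Summit.CriticalPhenomena.Ising3DConformalLimit.Cruxes.ExistsScaleCovariantLimit.TwoHierarchies
open Summit.CriticalPhenomena.Ising3DConformalLimit.ExistsScaleCovariantLimitNegative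
  (hasPointwiseScalingLimit_rhoPin)

/-- **Summit ⟹ NS.** -/
theorem nonSeparableModulus_of_summit (h : _root_.Ising3DConformalLimit) :
    MonotoneBlocking.NonSeparableModulus := by
  obtain ⟨ρ, Δ, S, hρ, -, hlim, hnd, -, -⟩ := h
  exact stub_nonSeparableModulus_of_uniformRegularity
    (stub_uniformRegularity_of_pinnedLimit ⟨_, hasPointwiseScalingLimit_rhoPin hρ hlim hnd⟩)

/-- **A refutation of NS refutes the conjunct `Ising3DConformalLimit`.** -/
theorem not_summit_of_not_nonSeparableModulus (h : ¬ MonotoneBlocking.NonSeparableModulus) :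
    ¬ _root_.Ising3DConformalLimit :=
  fun hs => h (nonSeparableModulus_of_summit hs)

/-- **NS ⟸ item 6150** (all-scale axial doubling), by the landed item maps. -/
theorem nonSeparableModulus_of_twoPointDoubling (hD : MirrorHoelderCompactness.TwoPointDoubling) :
    MonotoneBlocking.NonSeparableModulus :=
  stub_nonSeparableModulus_of_uniformRegularity (ItemMaps.uniformRegularity_of_doubling hD)

/-- So `¬NS` forces a failure of axial doubling: for every `κ > 0` some `n ≥ 1` with
`g(2n) < κ g(n)`. -/
theorem doubling_fails_of_not_nonSeparableModulus (h : ¬ MonotoneBlocking.NonSeparableModulus) :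
    ∀ κ : ℝ, 0 < κ → ∃ n : ℕ, 1 ≤ n ∧ g (2 * n) < κ * g n := by
  intro κ hκ
  by_contra hall
  push Not at hall
  exact h (nonSeparableModulus_of_twoPointDoubling ⟨κ, hκ, fun n hn => by exact_mod_cast hall n hn⟩)

/-- **NS with the non-separability restriction dropped** (one-point modulus at EVERY configuration). -/
def WithoutNonSep : Prop :=
  ∀ (n : ℕ) (K : Set (Fin n → E)), K ⊆ NonCoincident 3 n → IsCompact K → ∀ ε : ℝ, 0 < ε →
    ∃ η δ₀ : ℝ, 0 < η ∧ 0 < δ₀ ∧ ∀ δ ∈ Set.Ioo 0 δ₀, ∀ x ∈ K, ∀ (i : Fin n) (y : E),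
      ‖y - x i‖ < η → |F n δ (Function.update x i y) - F n δ x| < ε

/-- Dropping the restriction strengthens the statement (trivially). -/
theorem nonSeparableModulus_of_withoutNonSep (h : WithoutNonSep) :
    MonotoneBlocking.NonSeparableModulus := by
  intro n K hK hKc ε hε
  obtain ⟨η, δ₀, hη, hδ₀, hcl⟩ := h n K hK hKc ε hε
  exact ⟨1, η, δ₀, one_pos, hη, hδ₀, fun δ hδ x hx i y hy _ => hcl δ hδ x hx i y hy⟩

/-- … and the strengthened statement already follows from `UniformRegularity` (item 4658): clause (b)
on a compact closed thickening of `K` inside `NonCoincident` (the landed stub's proof, verbatim, never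
looked at separability). -/
theorem withoutNonSep_of_uniformRegularity
    (hUR : MirrorHoelderCompactness.UniformRegularity) : WithoutNonSep := by
  intro n K hKs hK ε hε
  obtain ⟨η₀, hη₀, hK'c, hK's⟩ := exists_compact_cthickening_subset_nonCoincident hKs hK
  obtain ⟨r, δ₀, hr, hδ₀, hb⟩ := (hUR.1 n (Metric.cthickening η₀ K) hK's hK'c).2 ε hε
  refine ⟨min η₀ r, δ₀, lt_min hη₀ hr, hδ₀, fun δ hδ x hx i y hy => ?_⟩
  have hd : dist (Function.update x i y) x ≤ ‖y - x i‖ := dist_update_le_norm_sub x i y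
  have hmem : Function.update x i y ∈ Metric.cthickening η₀ K :=
    Metric.mem_cthickening_of_dist_le _ x _ K hx (hd.trans (hy.le.trans (min_le_left _ _)))
  have hxK' : x ∈ Metric.cthickening η₀ K := Metric.self_subset_cthickening K hx
  exact hb δ hδ _ hmem x hxK' (hd.trans_lt (hy.trans_le (min_le_right _ _)))

/-- Hence from item 6150 alone: the separability bookkeeping buys nothing once doubling is known,
and (with `AxialPincer.twoPointDoubling_of_nonSeparableModulus`) `NS ↔ WithoutNonSep ↔ 6150`. -/
theorem withoutNonSep_of_twoPointDoubling (hD : MirrorHoelderCompactness.TwoPointDoubling) :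
    WithoutNonSep :=
  withoutNonSep_of_uniformRegularity (ItemMaps.uniformRegularity_of_doubling hD)

/-- **Exact refutation criterion** (with the lead's landed pincer): `¬NS ↔` doubling fails at some
scale for every `κ > 0`. -/
theorem not_nonSeparableModulus_iff_doubling_fails :
    ¬ MonotoneBlocking.NonSeparableModulus ↔ ∀ κ : ℝ, 0 < κ → ∃ n : ℕ, 1 ≤ n ∧ g (2 * n) < κ * g n := by
  refine ⟨doubling_fails_of_not_nonSeparableModulus, fun h hNS => ?_⟩
  obtain ⟨κ, hκ, hD⟩ :=
    MonotoneBlockingNonSeparableModulusAxialPincer.twoPointDoubling_of_nonSeparableModulus hNS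
  obtain ⟨n, hn, hlt⟩ := h κ hκ
  have := hD n hn
  unfold g at hlt
  linarith

/-- **The separability restriction is exactly redundant**: `NS ↔ WithoutNonSep`. -/
theorem nonSeparableModulus_iff_withoutNonSep : MonotoneBlocking.NonSeparableModulus ↔ WithoutNonSep :=
  ⟨fun h => withoutNonSep_of_twoPointDoubling
    (MonotoneBlockingNonSeparableModulusAxialPincer.twoPointDoubling_of_nonSeparableModulus h),
   nonSeparableModulus_of_withoutNonSep⟩

/-! ## §5 Targets (line `AxialPincer`, single stub `stub_twoPointDoubling` ≡ item 6150 verbatim)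

No stub of the picked line is attackable here without attacking item 6150 itself (its own chain):
`stub_twoPointDoubling` is FALSE iff NS is false iff the conjunct is false. Nothing to break.

## §6 Near-misses / not attempted

* `WithoutProximity` (drop `‖y − x i‖ < η`): false by the caged collinear configuration
  `(0,½,1,2)e₀` + Griffiths II (`F ≥ g(n)/g(2n) ≥ 1`) + Lebowitz (`F(update) → 0` as `y → ∞` at fixed
  mesh); routine, not written (uninformative for provers).
* A `K`-uniform `η` (`∃ η ∀ K`): believed false by scaling, but a proof needs a quantitative decay
  `g(Rn)/g(n) → 0` uniformly in `n` — not in the tree (only `c/n² ≤ g ≤ C/n`). Open here.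
-/
end Summit.CriticalPhenomena.Ising3DConformalLimit.Cruxes.NonSeparableModulus.Disproof

end
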